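/-
Copyright (c) 2026 the pub-hodgecm-mathlib formalisation cell (harness21).  Prover seat hodgecm-mathlib-K2Liu-p26 (g0): Track B «K2-LIT»,
#184♮ = hLiu418 = stmt-HodgeConjecture-24832; Road Φ of socket #41, «G3-inst» LAYER II (K2E5-plan (g7) 15:02:46Z (A) «=», K2Liu-p12 (g4) 15:03:14Z «=»;
census `K2/K2Liu-p26/g0/CENSUS-Sa-BadPlaceWhittakerSkewInstance.K2Liu-p26-g0.md` §1 LAYER II).
-/
import Summits.HodgeConjecture.HodgeConjecture.Theorems.K2LiuLocalWhittakerFactorSkew    -- ★ B4 §3 `integral_unipDeltaLoc_eq_integral_skew_addChar` (`hΨ` by value)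
import Summits.HodgeConjecture.HodgeConjecture.Theorems.K2LiuTateCharacterLocalTrace     -- ★ B3 `prod_adicComponent_adeleAddChar_eq` (Tate's local trace compatibility = `hΨ`)
import Summits.HodgeConjecture.HodgeConjecture.Theorems.K2LiuBadPlaceWhittakerEntire      -- ★ Φ5-tie `whittaker_integral_eq_setIntegral_ball` (+ ★ F3b balls)
import Literature.NumberTheory.Automorphic.AdeleAddCharLocalComponentsUnramified          -- ★ `IsGlobalAddChar.exists_hasConductorExp_adicComponent`
import HarnessLib

/-!
# Crux `HLiu418`, Road Φ of socket #41, «G3-inst» LAYER II — ROW G1's LOCAL FACTOR AT A (BAD) FINITE PLACE IS A SKEW-BALL INTEGRAL FOR TATE'S CHARACTER: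
# `∫_{N_Δ(L⁺_v)} conj ψ_S(ι_v y)·g(y) dν_v = ∫_{B(−(K−1))} g(n(t))·ψ_{L⁺,v}(−Tr tr(β t)) d(n^*ν_v)(t)`, `β = −½ S ⊗ 1`, no character letter left

Cell `hodgecm-mathlib`, crux item hLiu418 = `stmt-HodgeConjecture-24832`, route of record `HCCMUnconditional`; squad K2 ∕ K2Liu, road `K2_Liu`,
socket #41 `sig_K2LiuSiegelEisensteinContinuation`, Road Φ; consumer = the Φ9 tie at the places `v ∈ T` (row G3 «Φ5 BAD FINITE»), which holds row G1's
local integrals in the global-comap currency `∫ y : ↥(unipDeltaLoc v), conj ψ_S(ι_v y)·g(y) ∂ν_v` (★ G1-close `K2LiuWhittakerDeltaEulerProduct`) while the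
Φ5 organ (★ `K2LiuBadPlaceWhittaker{FarShells,Heads,Entire}`, ★ S-a `K2LiuBadPlaceWhittakerSkewInstance`) speaks Skew-ball integrals
`∫_{B(−k)} φ(t)·ψ(−τ tr(β t)) dμ(t)` with `ψ`, `τ` BY VALUE.  THEOREMS ONLY (no `def`, no `instance`, no `notation`, no named-fact hypothesis, no `sorry`);
lane `--supports stmt-HodgeConjecture-24832` (count-neutral helper; closes no socket by itself).

THE MATHEMATICS [Shimura1997, §18.1 (18.4), §18.3], [CasselsFrohlichANT1967, Ch. XV (Tate) §2.2], [Casselman1980, §3].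
* §1 **`integral_unipDeltaLoc_eq_integral_skew_tate`** — ★ B4 §3 with its one remaining letter `hΨ` DISCHARGED by ★ B3 (Tate's local trace compatibility
  `∏_{w∣v} ψ_{L,w}(x_w) = ψ_{L⁺,v}(Tr_{L⊗L⁺_v∕L⁺_v} x)`): for the K2Lit CM datum, ANY `g : H(L⁺_v) → ℂ`, any measure `ν` on `N_Δ(L⁺_v) = unipDeltaLoc v` and the
  coordinate homeomorphism `ψc : N_Δ(L⁺_v) ≃ₜ Skew` of ★ B2,
  `∫ conj ψ_S(ι_v y)·g(y) dν(y) = ∫_{Skew} g(n(t)) · ψ_{L⁺,v}(−Tr(tr(β·t))) d(ψc_*ν)(t)`, `ψ_{L⁺,v} := adeleAddCharAt L⁺ v` (Tate), `Tr := Algebra.trace L⁺_v (L ⊗ L⁺_v)`,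
  `β := −⅟2 • (S ⊗ 1)` — the Skew-carrier currency with NO by-value character letter left.
* §2 the letters the Skew-carrier files take BY VALUE, for THIS `ψ`, `τ`: `exists_hasConductorExp_adeleAddCharAt` (`∃ d, ψ_{F,v}` has conductor exponent `d`, every
  number field `F`, every `v`: ★ `IsGlobalAddChar.exists_hasConductorExp_adicComponent`); the `τ`-letters `hτ`∕`hτs`∕`hτc` are ★ B3
  (`toLocalRing_algebraTrace`, `algebraTrace_toLocalRing_mul`, `continuous_algebraTrace_localRing`), `hψ` is ★ `continuous_adeleAddCharAt` — cited, not restated.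
* §3 **`integral_unipDeltaLoc_eq_setIntegral_ball_tate`** — §1 followed by ★ Φ5-tie `whittaker_integral_eq_setIntegral_ball`: granted the far-shell vanishing beyond
  `K` (letter `hshell`, = ★ F4b-1 `setIntegral_farShell_eq_zero` for the Siegel-section pull-backs) and absolute convergence (`hint`), row G1's local factor IS the
  compact-ball integral `∫_{B(−(K−1))} g(n(t))·ψ_{L⁺,v}(−Tr tr(β t)) d(ψc_*ν)` — the object of ★ S-a's bound and lattice-support clauses and of ★ Φ5-tie's
  `differentiable_whittaker`.
HONEST LABEL.  Count-neutral helper; it retires nothing by itself: `HC_CM` is proved only modulo the 7 printed citations (2 remaining named inputs: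
hLiu418 = `stmt-HodgeConjecture-24832`, h413 = `stmt-HodgeConjecture-24833`) until rung 0 closes.

## References
* [Shimura1997] G. Shimura, *Euler products and Eisenstein series*, CBMS 93 (1997): §18.1 (18.4), §18.3 (local Whittaker integrals of Siegel sections).
* [CasselsFrohlichANT1967] J. Tate, in Cassels–Fröhlich (eds.), *Algebraic Number Theory* (1967), Ch. XV §2.2 (local components of `ψ`, conductor), §4.1.
* [Casselman1980] W. Casselman, Compositio Math. 40 (1980), §3 (Karel's lemma: the Whittaker integral is a compact-ball integral).
* [WeilBNT1967] A. Weil, *Basic Number Theory* (1967), Ch. IV §2 (characters of local fields have an order∕conductor).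
-/

set_option autoImplicit false
-- the mandated namespace repeats the single-problem summit's segment (`HodgeConjecture.HodgeConjecture`)
set_option linter.dupNamespace false

noncomputable section

open scoped Matrix ComplexConjugate NNReal ENNReal
open NumberField IsDedekindDomain Matrix MeasureTheory
open Literature.NumberTheory.Automorphic Literature.NumberTheory.Automorphic.UnitaryGroup Literature.NumberTheory.GaloisRepresentations
open Literature.NumberTheory.GelbartRogawski1991 Literature.NumberTheory.GelbartRogawski1991.GRConstruction
open Literature.NumberTheory.GelbartRogawski1991.AdaptedBlocks
open Literature.NumberTheory.GelbartRogawski1991.UnitaryDualPair.LocalSplitting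
open Literature.NumberTheory.K2Lit Literature.NumberTheory.K2Lit.SiegelDoubled Literature.NumberTheory.K2Lit.LocalSiegelDoubled
open Summit.HodgeConjecture.HodgeConjecture.Cruxes.HLiu418.K2LiuSiegelUnipotentFourierDefs
open Summit.HodgeConjecture.HodgeConjecture.Cruxes.HLiu418.K2LiuSiegelUnipotentLocalDefs
open Summit.HodgeConjecture.HodgeConjecture.Cruxes.HLiu418.K2LiuLocalWhittakerFactorSkew
open Summit.HodgeConjecture.HodgeConjecture.Cruxes.HLiu418.K2LiuTateCharacterLocalTrace
open Summit.HodgeConjecture.HodgeConjecture.Cruxes.HLiu418.K2LiuBadPlaceWhittakerEntire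

namespace Summit.HodgeConjecture.HodgeConjecture.Cruxes.HLiu418.K2LiuBadPlaceLocalFactorSkew

/-! ## §2 (stated first, general number field) Tate's local character has a conductor exponent at every finite place -/

/-- **`ψ_{F,v} = adeleAddCharAt F v` has SOME conductor exponent `d`** at every finite place `v` of every number field `F` (the letter `hdψ` of the
Skew-carrier Whittaker files for Tate's character: ★ `IsGlobalAddChar.exists_hasConductorExp_adicComponent` at ★ `isGlobalAddChar_adeleAddChar`;
`adeleAddCharAt = adicComponent` definitionally). [cite: WeilBNT1967, Ch. IV §2] [cite: CasselsFrohlichANT1967, Ch. XV §2.2] -/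
theorem exists_hasConductorExp_adeleAddCharAt (F : Type) [Field F] [NumberField F] (v : HeightOneSpectrum (𝓞 F)) :
    ∃ d : ℤ, (adeleAddCharAt F v).HasConductorExp d :=
  (isGlobalAddChar_adeleAddChar F).exists_hasConductorExp_adicComponent v

variable (L : Type) [Field L] [NumberField L] [IsCMField L]
variable {N M n : ℕ} (e : Fin N × Fin M ≃ Fin n)
  (dV : Fin N → L) (hdV : ∀ i, IsCMField.complexConj L (dV i) = dV i)
  (dW : Fin M → L) (hdW : ∀ i, IsCMField.complexConj L (dW i) = dW i)
  (v : HeightOneSpectrum (𝓞 (Fp L)))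

section Skew

variable [MeasurableSpace ↥(unipDeltaLoc L e dV hdV dW hdW v)] [BorelSpace ↥(unipDeltaLoc L e dV hdV dW hdW v)]
  (Sk : AddSubgroup (Matrix (Fin n) (Fin n) (LocalRing L v)))
  (hSk : ∀ t, t ∈ Sk ↔ (t.map (conjLocal L (IsCMField.complexConj L) v))ᵀ * gramS (Fp L) L v n (gramR L e dV hdV dW hdW) +
    gramS (Fp L) L v n (gramR L e dV hdV dW hdW) * t = 0)
  [MeasurableSpace Sk] [BorelSpace Sk]

/-! ## §1 Row G1's local factor in the Skew currency, for Tate's character (no letter left) -/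

include hSk in
/-- **ROW G1's LOCAL FACTOR AT THE SKEW CARRIER, TATE'S CHARACTER.**  ★ B4 §3 with `hΨ` discharged by ★ B3: for the Fourier index `S ∈ M_n(L)`, any
`g : H(L⁺_v) → ℂ`, any measure `ν` on `N_Δ(L⁺_v) = unipDeltaLoc v` and the coordinate homeomorphism `ψc` of ★ B2 (`(ψc u).1 = B(matA u)`):
`∫ conj ψ_S(ι_v y)·g(y) dν(y) = ∫_{Skew} g(n(t)) · ψ_{L⁺,v}(−Tr(tr(β·t))) d(ψc_*ν)(t)` with `ψ_{L⁺,v} = adeleAddCharAt L⁺ v`, `Tr = Algebra.trace L⁺_v (L ⊗ L⁺_v)`,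
`β = −⅟2 • (S ⊗ 1)`. [cite: Shimura1997, §18.1 (18.4)] [cite: CasselsFrohlichANT1967, Ch. XV §2.2] -/
theorem integral_unipDeltaLoc_eq_integral_skew_tate (ψc : ↥(unipDeltaLoc L e dV hdV dW hdW v) ≃ₜ Sk)
    (hψc : ∀ u, (ψc u).1 = blkB (matA (Fp L) L (IsCMField.complexConj L) v n
      (u : UnitaryGroup.localPi L (IsCMField.complexConj L) (n + n) (hermD L e dV hdV dW hdW) v)))
    (ν : Measure ↥(unipDeltaLoc L e dV hdV dW hdW v)) (S : Matrix (Fin n) (Fin n) L)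
    (g : UnitaryGroup.localPi L (IsCMField.complexConj L) (n + n) (hermD L e dV hdV dW hdW) v → ℂ) :
    ∫ y, conj ((unipDeltaChar L e dV hdV dW hdW S (locToAdelic L e dV hdV dW hdW v
        (y : UnitaryGroup.localPi L (IsCMField.complexConj L) (n + n) (hermD L e dV hdV dW hdW) v)) : Circle) : ℂ) *
      g (y : UnitaryGroup.localPi L (IsCMField.complexConj L) (n + n) (hermD L e dV hdV dW hdW) v) ∂ν =
    ∫ t, g (nElem (Fp L) L (IsCMField.complexConj L) v n (hermD_eq_map_gramD L e dV hdV dW hdW) t.1 ((hSk t.1).1 t.2)) *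
      ((adeleAddCharAt (Fp L) v (-(Algebra.trace (v.adicCompletion (Fp L)) (LocalRing L v)
        (Matrix.trace ((-(⅟(2 : LocalRing L v) • S.map (algebraMap L (LocalRing L v)))) * t.1)))) : Circle) : ℂ) ∂(Measure.map ψc ν) :=
  integral_unipDeltaLoc_eq_integral_skew_addChar L e dV hdV dW hdW v Sk hSk ψc hψc ν S g
    (ψ := adeleAddCharAt (Fp L) v) (τ := fun x => Algebra.trace (v.adicCompletion (Fp L)) (LocalRing L v) x)
    (fun x => prod_adicComponent_adeleAddChar_eq L v x)

/-! ## §3 … and it is the compact-ball integral of the Φ5 organ -/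

include hSk in
/-- **ROW G1's LOCAL FACTOR IS THE SKEW-BALL INTEGRAL** (Karel's lemma, ★ Φ5-tie `whittaker_integral_eq_setIntegral_ball`): granted the far-shell vanishing beyond
`K` of the Skew integrand (`hshell`; ★ F4b-1 `setIntegral_farShell_eq_zero` for Siegel-section pull-backs) and its absolute convergence (`hint`),
`∫ conj ψ_S(ι_v y)·g(y) dν(y) = ∫_{B(−(K−1))} g(n(t))·ψ_{L⁺,v}(−Tr tr(β t)) d(ψc_*ν)(t)` — the object bounded and supported by ★ S-a
`K2LiuBadPlaceWhittakerSkewInstance` and made entire by ★ Φ5-tie `differentiable_whittaker`. [cite: Casselman1980, §3] [cite: Shimura1997, §18.3] -/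
theorem integral_unipDeltaLoc_eq_setIntegral_ball_tate {π : v.adicCompletion (Fp L)} (hπ : Valued.v π = WithZero.exp (-1 : ℤ))
    (ψc : ↥(unipDeltaLoc L e dV hdV dW hdW v) ≃ₜ Sk)
    (hψc : ∀ u, (ψc u).1 = blkB (matA (Fp L) L (IsCMField.complexConj L) v n
      (u : UnitaryGroup.localPi L (IsCMField.complexConj L) (n + n) (hermD L e dV hdV dW hdW) v)))
    (ν : Measure ↥(unipDeltaLoc L e dV hdV dW hdW v)) (S : Matrix (Fin n) (Fin n) L)
    (g : UnitaryGroup.localPi L (IsCMField.complexConj L) (n + n) (hermD L e dV hdV dW hdW) v → ℂ) {K : ℤ}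
    (hshell : ∀ k : ℤ, K ≤ k →
      ∫ t in {t : Sk | ∀ i j (w : PlacesOver L v), Valued.v (t.1 i j w) ≤ Valued.v (toPlace v w π) ^ (-k)} \
          {t : Sk | ∀ i j (w : PlacesOver L v), Valued.v (t.1 i j w) ≤ Valued.v (toPlace v w π) ^ (-k + 1)},
        g (nElem (Fp L) L (IsCMField.complexConj L) v n (hermD_eq_map_gramD L e dV hdV dW hdW) t.1 ((hSk t.1).1 t.2)) *
          ((adeleAddCharAt (Fp L) v (-(Algebra.trace (v.adicCompletion (Fp L)) (LocalRing L v)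
            (Matrix.trace ((-(⅟(2 : LocalRing L v) • S.map (algebraMap L (LocalRing L v)))) * t.1)))) : Circle) : ℂ) ∂(Measure.map ψc ν) = 0)
    (hint : Integrable (fun t : Sk =>
      g (nElem (Fp L) L (IsCMField.complexConj L) v n (hermD_eq_map_gramD L e dV hdV dW hdW) t.1 ((hSk t.1).1 t.2)) *
        ((adeleAddCharAt (Fp L) v (-(Algebra.trace (v.adicCompletion (Fp L)) (LocalRing L v)
          (Matrix.trace ((-(⅟(2 : LocalRing L v) • S.map (algebraMap L (LocalRing L v)))) * t.1)))) : Circle) : ℂ)) (Measure.map ψc ν)) :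
    ∫ y, conj ((unipDeltaChar L e dV hdV dW hdW S (locToAdelic L e dV hdV dW hdW v
        (y : UnitaryGroup.localPi L (IsCMField.complexConj L) (n + n) (hermD L e dV hdV dW hdW) v)) : Circle) : ℂ) *
      g (y : UnitaryGroup.localPi L (IsCMField.complexConj L) (n + n) (hermD L e dV hdV dW hdW) v) ∂ν =
    ∫ t in {t : Sk | ∀ i j (w : PlacesOver L v), Valued.v (t.1 i j w) ≤ Valued.v (toPlace v w π) ^ (-(K - 1))},
      g (nElem (Fp L) L (IsCMField.complexConj L) v n (hermD_eq_map_gramD L e dV hdV dW hdW) t.1 ((hSk t.1).1 t.2)) *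
        ((adeleAddCharAt (Fp L) v (-(Algebra.trace (v.adicCompletion (Fp L)) (LocalRing L v)
          (Matrix.trace ((-(⅟(2 : LocalRing L v) • S.map (algebraMap L (LocalRing L v)))) * t.1)))) : Circle) : ℂ) ∂(Measure.map ψc ν) := by
  rw [integral_unipDeltaLoc_eq_integral_skew_tate L e dV hdV dW hdW v Sk hSk ψc hψc ν S g]
  exact whittaker_integral_eq_setIntegral_ball (Fp L) L v n hπ Sk (Measure.map ψc ν)
    (φ := fun _ t => g (nElem (Fp L) L (IsCMField.complexConj L) v n (hermD_eq_map_gramD L e dV hdV dW hdW) t.1 ((hSk t.1).1 t.2)))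
    (χ := fun t : Sk => ((adeleAddCharAt (Fp L) v (-(Algebra.trace (v.adicCompletion (Fp L)) (LocalRing L v)
      (Matrix.trace ((-(⅟(2 : LocalRing L v) • S.map (algebraMap L (LocalRing L v)))) * t.1)))) : Circle) : ℂ))
    (K := K) (fun _ k hk => hshell k hk) 0 hint

end Skew

end Summit.HodgeConjecture.HodgeConjecture.Cruxes.HLiu418.K2LiuBadPlaceLocalFactorSkew

end
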